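import Mathlib
import Literature.NumberTheory.LFunctions.Zhang2022.Section16Eq1610Assembly
import Literature.NumberTheory.LFunctions.Zhang2022.Section16Eq1610Sizes
import Literature.NumberTheory.LFunctions.Zhang2022.Section16Eq1610Numeric
import Literature.NumberTheory.LFunctions.Zhang2022.Section15ResidueNonvanishing
import Literature.NumberTheory.LFunctions.ZetaClassicalRegionBounds
import Literature.NumberTheory.LFunctions.Zhang2022.AppendixAEqA4
import HarnessLib

/-!
# Zhang (2022), §16 (16.10): `𝒟₂(d,l) = λ₂(d)Σ_{j=1,2} ℛ₂ⱼd^{βⱼ}ℳ₂(d,l;1−βⱼ) + (error)` — the contour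
# shift of the §16.u023 integral for all large `D` under (A), with the DERIVABLE error term

Topic `Literature/NumberTheory/LFunctions/Zhang2022` (Landau–Siegel audit tree; verdict-neutral).
Y. Zhang, *Discrete mean estimates and the Landau–Siegel zero*, arXiv:2211.02515v1 (2022)
[Zhang2022LandauSiegel] — **an unrefereed manuscript under adjudication**; nothing here asserts its
Theorems 1–2. DAG node `Z22:(16.10)` [Z22 p.92, tex L4550–L4556] (typed CLAIM
`Typed.Section16A.Eq16_10 c′`, error `O(ε₁) = O(e^{−c𝓛^{1/10}})`):

> Assume `dl < P₂²`, and `(dl,D) = 1`. Note that `P₄/d > T`. In a way similar to the proof of (15.15),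
> we deduce that `𝒟₂(d,l) = λ₂(d) Σ_{j=1,2} ℛ₂ⱼ d^{βⱼ} ℳ₂(d,l;1−βⱼ) + O(ε₁)` (16.10)

WHAT IS PROVED. `integral_u023_sub_residues_le`: for all large `D`, every real primitive `χ (mod D)`
with (A), every `d, l ≥ 1` with `dl < P₂²`,
`‖(2πi)⁻¹∫_{(1)} [integrand of §16.u023] − Σ_{j=1,2} ℛ₂ⱼ d^{βⱼ} ℳ₂(d,l;1−βⱼ)‖ ≤ C·∏_{q∣dl}(1 + c/q^{9/10})·𝓛⁻²⁰⁰⁰`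
— from the holomorphy and the bound of `ℳ₂(d,l;·)` on `σ > 9/10` (nodes §16.u021an, §16.u022, taken as
hypotheses BY NAME: `Typed.Section16A.Step16_u021an c′`, `Step16_u022 c′`), and
`eq16_10P_of`: with the display §16.u023 (`Typed.Section16A.Step16_u023 c′`, also a hypothesis by name),
`‖𝒟₂(d,l) − λ₂(d)Σ_{j=1,2}ℛ₂ⱼd^{βⱼ}ℳ₂(d,l;1−βⱼ)‖ ≤ C·e^{−c𝓛¹⁰} + C·‖λ₂(d)‖·∏_{q∣dl}(1 + c/q^{9/10})·𝓛⁻²⁰⁰⁰`.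
The argument is the manuscript's ("in a way similar to the proof of Lemma 8.4": Landau's broken line
`Re s = −η`, `|t| ≤ H`, p.44), run on the tree's Gaussian-kernel engine `GaussKernelContour` with
`H = 𝓛²⁰`, `η = c/(4(𝓛 + log(H+8)))` (`c` the constant of the zero-free region for `L(·,χ)`, tree
`Lemma84.exceptional_package`), the classical region for `ζ` (`ZetaClassicalRegion.exists_zeroFreeRegion_bounds`),
the residues `ℛ₂ⱼ` identified in the tree (`Skeleton.tendsto_residue1611_one/two`), the saving
`(d/P₄)^{η} ≤ T^{−18η} ≤ e^{−(9c/4)𝓛^{1/10}}` on the left line (this is where "`P₄/d > T`" enters: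
`d ≤ dl < P₂² = PT⁻²⁰` and `P₄ = PT⁻²t₀`), and the Gaussian `e^{−(H−1)²/(4𝓛³⁰)}` on the other pieces.

WHAT IS NOT PROVED, AND WHY (finding for the adjudication; numbers, not adjectives). The typed node
`Eq16_10` carries the printed error `C·e^{−c𝓛^{1/10}}`. The function (16.11) has, besides `−β₁, −β₂`, the
simple pole `s = ρ̃ − 1` from `1/L(1+s,χ)` at the exceptional zero `ρ̃` of Lemma 5.5, whose residue the
manuscript "regards as an acceptable error" (p.85, tex L4224). Its size is
`≍ |ζ(ρ̃+β₁)|·|ℳ₂(d,l;ρ̃)|·|ζ(ρ̃)|⁻¹·|L′(ρ̃,χ)|⁻¹·|ρ̃−1+β₂|⁻¹` with `|ζ(ρ̃)|⁻¹ ≍ 1 − ρ̃` and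
`1 − ρ̃ ≍ L(1,χ)/L′(1,χ)`, which under (A) is only `≤ K𝓛⁻²⁰²²` (tree `Lemma84.exceptional_package`), while
`|ζ(ρ̃+β₁)|, |ρ̃−1+β₂|⁻¹ ≍ α⁻¹ = 𝓛⁹/π`: the residue is `O(𝓛¹⁹⁻²⁰²²·‖ℳ₂‖)`, polynomially and not
exponentially small (`Eq1610.norm_excZero_residue_le`). So the exponential error of (16.10)/(15.15) is not
derivable from (A); the polynomial error proved here is what (16.12) (error `o(p)`) consumes.

## References

* Y. Zhang, arXiv:2211.02515v1 (2022), §16 (16.9)–(16.12) p.92; §15 (15.15)–(15.16) p.85; §8 proofs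
  of Lemmas 8.2, 8.4 pp.44–47; §5 Lemma 5.5. [cite: Zhang2022LandauSiegel, §16 (16.10) p.92]
* H. L. Montgomery, R. C. Vaughan, *Multiplicative Number Theory I*, CUP 2007, §6.2, Thm 11.4.
  [cite: MontgomeryVaughan2007, §6.2]
-/

noncomputable section

open Complex Real Filter Topology Set MeasureTheory
open Literature.NumberTheory.LFunctions.Zhang2022
open Literature.NumberTheory.LFunctions.Zhang2022.Skeleton
open Literature.NumberTheory.LFunctions.Zhang2022.Typed.Section16A

namespace Literature.NumberTheory.LFunctions.Zhang2022.Eq1610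

/-! ## Sizes of the campaign parameters -/

section Params

variable (c' : ℝ) {D : ℕ}

/-- The shift sizes: for `𝓛 ≥ 3` and `|c′α𝓛| ≤ 1/14`, `α/2 ≤ b₁ ≤ 2α`, `α ≤ b₂ ≤ 3α`, `b₁ ≠ b₂`,
`b₁, b₂ < 1`, `‖β₁‖ ≤ 1` (`α = π𝓛⁻⁹ ≤ 1/6`). [cite: Zhang2022LandauSiegel, §2 (2.13)] -/
theorem b_sizes (hL : 3 ≤ ell D) (he : |c' * alpha D * ell D| ≤ 1 / 14) :
    alpha D / 2 ≤ b1 c' D ∧ b1 c' D ≤ 2 * alpha D ∧ alpha D ≤ b2 c' D ∧ b2 c' D ≤ 3 * alpha D ∧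
      b1 c' D ≠ b2 c' D ∧ b1 c' D < 1 ∧ b2 c' D < 1 ∧ ‖beta1 c' D‖ ≤ 1 ∧ 0 < alpha D ∧
      alpha D = π / ell D ^ 9 := by
  have hα := ResidueValues.alpha_pos hL
  have hα1 : alpha D ≤ 1 / 6 := by
    rw [Section2.alpha_eq_pi_div_ell9, div_le_iff₀ (by positivity)]
    have h9 : (3 : ℝ) ^ 9 ≤ ell D ^ 9 := pow_le_pow_left₀ (by norm_num) hL 9
    nlinarith [Real.pi_lt_four]
  have he' := abs_le.mp he
  have hb1 : b1 c' D = alpha D * (1 - 5 * (c' * alpha D * ell D)) := by rw [b1]; ring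
  have hb2 : b2 c' D = alpha D * (2 + 2 * (c' * alpha D * ell D)) := by rw [b2]; ring
  refine ⟨by rw [hb1]; nlinarith, by rw [hb1]; nlinarith, by rw [hb2]; nlinarith, by rw [hb2]; nlinarith,
    ?_, by rw [hb1]; nlinarith, by rw [hb2]; nlinarith, ?_, hα, Section2.alpha_eq_pi_div_ell9 D⟩
  · rw [hb1, hb2]; intro h
    have : alpha D * (1 + 7 * (c' * alpha D * ell D)) = 0 := by linarith
    rcases mul_eq_zero.mp this with h1 | h1
    · linarith
    · linarith
  · exact (ResidueValues.norm_beta1_le c' hL he).trans (by linarith)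

/-- `P₄`: `1 ≤ P₄ ≤ e^{𝓛⁹}𝓛⁵¹⁹` for `𝓛 ≥ 3` (`P₄ = PT⁻²t₀`, `T² < P`, `t₀ ≥ 1`, `T ≥ 1`).
[cite: Zhang2022LandauSiegel, §6 p.30] -/
theorem P4_sizes (hL : 3 ≤ ell D) : 1 ≤ P4 D ∧ P4 D ≤ Real.exp (ell D ^ 9) * ell D ^ 519 := by
  have hℓ : 0 < ell D := by linarith
  have hP0 : 0 < bigP D := Real.exp_pos _
  have hT0 : 0 < bigT D := Real.exp_pos _
  have hT1 : 1 ≤ bigT D := Real.one_le_exp (Real.rpow_nonneg hℓ.le _)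
  have ht0 : 1 ≤ t0 D := by rw [t0]; exact one_le_pow₀ (by linarith)
  have ht0' : t0 D = ell D ^ 519 := rfl
  constructor
  · have hTP : bigT D ^ 2 < bigP D := Typed.Section16B.bigT_sq_lt_bigP (by linarith)
    have h1 : 1 ≤ bigP D / bigT D ^ 2 := by
      rw [le_div_iff₀ (pow_pos hT0 2)]; linarith
    calc (1 : ℝ) = 1 * 1 := by ring
      _ ≤ bigP D / bigT D ^ 2 * t0 D := mul_le_mul h1 ht0 zero_le_one (by linarith)
      _ = P4 D := rfl
  · have h1 : bigP D / bigT D ^ 2 ≤ bigP D := div_le_self hP0.le (one_le_pow₀ hT1)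
    calc P4 D = bigP D / bigT D ^ 2 * t0 D := rfl
      _ ≤ bigP D * t0 D := mul_le_mul_of_nonneg_right h1 (by linarith)
      _ = Real.exp (ell D ^ 9) * ell D ^ 519 := by rw [ht0', bigP]

/-- **"`P₄/d > T`" quantified**: for `d ≤ dl < P₂² = PT⁻²⁰`, `d/P₄ ≤ T⁻¹⁸` (`P₄ = PT⁻²t₀`, `t₀ ≥ 1`),
hence `(d/P₄)^{η} ≤ exp(−18η𝓛^{1.1})` for `η ≥ 0`. [cite: Zhang2022LandauSiegel, §16 (16.10) p.92] -/
theorem div_P4_rpow_le (hL : 3 ≤ ell D) {d : ℕ} {x : ℝ} (hdx : (d : ℝ) ≤ x)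
    (hx : x < Skeleton.P2 D ^ 2) {η : ℝ} (hη : 0 ≤ η) :
    ((d : ℝ) / P4 D) ^ η ≤ Real.exp (-(18 * η * ell D ^ (1.1 : ℝ))) := by
  have hℓ : 0 < ell D := by linarith
  have hP0 : 0 < bigP D := Real.exp_pos _
  have hT0 : 0 < bigT D := Real.exp_pos _
  have hP4 := ResidueValues.P4_pos hL
  have ht0 : 1 ≤ t0 D := by rw [t0]; exact one_le_pow₀ (by linarith)
  -- `P₂² = P/T²⁰`
  have hP2 : Skeleton.P2 D ^ 2 = bigP D / bigT D ^ 20 := by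
    have hsq : (bigP D ^ (0.5 : ℝ)) ^ 2 = bigP D := by
      rw [← Real.rpow_natCast (bigP D ^ (0.5 : ℝ)) 2, ← Real.rpow_mul hP0.le]; norm_num
    rw [Skeleton.P2, div_pow, hsq, ← pow_mul]
  -- `d/P₄ ≤ T⁻¹⁸`
  have hdP : (d : ℝ) / P4 D ≤ (bigT D ^ 18)⁻¹ := by
    rw [div_le_iff₀ hP4]
    have h1 : (d : ℝ) ≤ bigP D / bigT D ^ 20 := by rw [← hP2]; linarith
    refine h1.trans ?_
    rw [P4, div_le_iff₀ (pow_pos hT0 20)]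
    have hT18 : 0 < bigT D ^ 18 := pow_pos hT0 18
    calc bigP D = (bigT D ^ 18)⁻¹ * (bigP D / bigT D ^ 2 * 1) * bigT D ^ 20 := by
          field_simp
      _ ≤ (bigT D ^ 18)⁻¹ * (bigP D / bigT D ^ 2 * t0 D) * bigT D ^ 20 := by
          gcongr
  have hd0 : 0 ≤ (d : ℝ) / P4 D := div_nonneg (Nat.cast_nonneg d) hP4.le
  have hT18 : (bigT D ^ 18)⁻¹ = Real.exp (-(18 * ell D ^ (1.1 : ℝ))) := by
    rw [bigT, ← Real.exp_nat_mul, ← Real.exp_neg]; push_cast; ring_nf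
  calc ((d : ℝ) / P4 D) ^ η ≤ ((bigT D ^ 18)⁻¹) ^ η := Real.rpow_le_rpow hd0 hdP hη
    _ = Real.exp (-(18 * η * ell D ^ (1.1 : ℝ))) := by
        rw [hT18, ← Real.exp_mul]; ring_nf

end Params

/-! ## The two zero-free packages at the campaign parameters -/

section Packages

/-- The classical region for `ζ` at height `≤ H + 2`: if `2η ≤ 4c̄/log(H+5)` then for `w ≠ 1`,
`Re w ≥ 1 − 2η`, `|Im w| ≤ H + 2`: `ζ(w) ≠ 0` and `‖ζ(w) − (w−1)⁻¹‖, ‖ζ(w)⁻¹‖ ≤ B_ζ = C_ζ log(H+5)`.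
[cite: MontgomeryVaughan2007, §6.2] -/
theorem zeta_package_of {cbar Cζ η H Bζ : ℝ} (hcbar : 0 < cbar) (hCζ : 0 < Cζ)
    (hζ : ∀ s : ℂ, s ≠ 1 → 1 - 4 * cbar / Real.log (|s.im| + 3) ≤ s.re →
      riemannZeta s ≠ 0 ∧ ‖riemannZeta s - 1 / (s - 1)‖ ≤ Cζ * Real.log (|s.im| + 3) ∧
        ‖(riemannZeta s)⁻¹‖ ≤ Cζ * Real.log (|s.im| + 3) ∧
        ‖deriv riemannZeta s / riemannZeta s + 1 / (s - 1)‖ ≤ Cζ * Real.log (|s.im| + 3))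
    (hBζ : Bζ = Cζ * Real.log (H + 5)) (h2η : 2 * η ≤ 4 * cbar / Real.log (H + 5)) :
    ∀ w : ℂ, w ≠ 1 → 1 - 2 * η ≤ w.re → |w.im| ≤ H + 2 →
      riemannZeta w ≠ 0 ∧ ‖riemannZeta w - (w - 1)⁻¹‖ ≤ Bζ ∧ ‖(riemannZeta w)⁻¹‖ ≤ Bζ := by
  intro w hw1 hwre hwim
  have him0 : 0 ≤ |w.im| := abs_nonneg _
  have hlog3 : 0 < Real.log (|w.im| + 3) := Real.log_pos (by linarith only [him0])
  have hlogle : Real.log (|w.im| + 3) ≤ Real.log (H + 5) :=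
    Real.log_le_log (by linarith only [him0]) (by linarith only [hwim])
  have hreg : 1 - 4 * cbar / Real.log (|w.im| + 3) ≤ w.re := by
    have : 4 * cbar / Real.log (H + 5) ≤ 4 * cbar / Real.log (|w.im| + 3) :=
      div_le_div_of_nonneg_left (by positivity) hlog3 hlogle
    linarith only [this, h2η, hwre]
  obtain ⟨hne, hsub, hinv, -⟩ := hζ w hw1 hreg
  refine ⟨hne, ?_, ?_⟩
  · rw [← one_div, hBζ]
    exact hsub.trans (mul_le_mul_of_nonneg_left hlogle hCζ.le)
  · rw [hBζ]; exact hinv.trans (mul_le_mul_of_nonneg_left hlogle hCζ.le)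

/-- The zero-free package for `L(·,χ)` at height `≤ H + 1`: with `ℒ₁ = 𝓛 + log(H+8)`,
`η = c/(4ℒ₁)`, `M_inv = (C+1)ℒ₁`, for `Re s ≥ 1 − 2η`, `|Im s| ≤ H + 1`, `s ≠ ρ̃`: `L(s,χ) ≠ 0` and
`‖L(s,χ)⁻¹‖ ≤ M_inv(1 + ‖s − ρ̃‖⁻¹)`. [cite: Zhang2022LandauSiegel, §5 Lemma 5.5] -/
theorem L_package_of {D : ℕ} [NeZero D] {χ : DirichletCharacter ℂ D} {cL CL ρt L η H ℒ₁ Minv : ℝ}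
    (hcL : 0 < cL) (hCL : 0 ≤ CL)
    (hLreg : ∀ s : ℂ, 1 - cL / (Real.log D + Real.log (|s.im| + 4)) ≤ s.re → s ≠ (ρt : ℂ) →
      χ.LFunction s ≠ 0 ∧
        ‖(χ.LFunction s)⁻¹‖ ≤ CL * (Real.log D + Real.log (|s.im| + 4)) * (1 + ‖s - ρt‖⁻¹))
    (hLD : Real.log D = L) (hL0 : 0 < L) (hH1 : 1 ≤ H) (hℒ₁ : ℒ₁ = L + Real.log (H + 8))
    (hη : η = cL / (4 * ℒ₁)) (hMinv : Minv = (CL + 1) * ℒ₁) :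
    ∀ s : ℂ, 1 - 2 * η ≤ s.re → |s.im| ≤ H + 1 → s ≠ (ρt : ℂ) →
      χ.LFunction s ≠ 0 ∧ ‖(χ.LFunction s)⁻¹‖ ≤ Minv * (1 + ‖s - ρt‖⁻¹) := by
  intro s hsre hsim hsρ
  have him0 : 0 ≤ |s.im| := abs_nonneg _
  have hlog4 : 0 ≤ Real.log (|s.im| + 4) := Real.log_nonneg (by linarith only [him0])
  have hlog8 : 0 ≤ Real.log (H + 8) := Real.log_nonneg (by linarith only [hH1])
  have hlogle : Real.log (|s.im| + 4) ≤ Real.log (H + 8) :=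
    Real.log_le_log (by linarith only [him0]) (by linarith only [hsim])
  have hden : 0 < L + Real.log (|s.im| + 4) := by linarith only [hL0, hlog4]
  have hℒ₁0 : 0 < ℒ₁ := by rw [hℒ₁]; linarith only [hL0, hlog8]
  have hreg : 1 - cL / (Real.log D + Real.log (|s.im| + 4)) ≤ s.re := by
    rw [hLD]
    have h1 : 2 * η ≤ cL / (L + Real.log (|s.im| + 4)) := by
      calc 2 * η = cL / (2 * ℒ₁) := by rw [hη]; field_simp; ring
        _ ≤ cL / (L + Real.log (|s.im| + 4)) :=
            div_le_div_of_nonneg_left hcL.le hden (by rw [hℒ₁]; linarith only [hlogle, hlog4, hL0])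
    linarith only [h1, hsre]
  obtain ⟨hne, hinv⟩ := hLreg s hreg hsρ
  refine ⟨hne, hinv.trans ?_⟩
  rw [hLD]
  have hfac : CL * (L + Real.log (|s.im| + 4)) ≤ Minv := by
    rw [hMinv, hℒ₁]
    have h1 : L + Real.log (|s.im| + 4) ≤ L + Real.log (H + 8) := by linarith only [hlogle]
    calc CL * (L + Real.log (|s.im| + 4)) ≤ CL * (L + Real.log (H + 8)) :=
          mul_le_mul_of_nonneg_left h1 hCL
      _ ≤ (CL + 1) * (L + Real.log (H + 8)) := by
          have : 0 ≤ 1 * (L + Real.log (H + 8)) := by positivity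
          linarith only [this]
  exact mul_le_mul_of_nonneg_right hfac (by positivity)

end Packages

/-! ## The contour shift for all large `D` under (A) -/

section Main

variable (c' : ℝ)

/-- **(16.10) at the integral level, for all large `D` under (A), with the derivable error.** From
§16.u021an (`ℳ₂(d,l;·)` holomorphic on `σ > 9/10`) and §16.u022 (`‖ℳ₂(d,l;s)‖ ≤ C∏_{q∣dl}(1 + cq^{−9/10})`
there), both as hypotheses BY NAME: there are `c, C` such that for all large `D`, every real primitive
`χ (mod D)` with (A), all `d, l ≥ 1` with `dl < P₂²`,
`‖(2πi)⁻¹∫_{(1)} ζ(1+s+β₁)ℳ₂(d,l;1+s)/(ζ(1+s)L(1+s,χ))·P₄^{s+β₂}d^{−s}ω₁(s+β₂)(s+β₂)⁻¹ds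
 − Σ_{j=1,2} ℛ₂ⱼ d^{βⱼ} ℳ₂(d,l;1−βⱼ)‖ ≤ C·∏_{q∣dl}(1 + c/q^{9/10})·𝓛⁻²⁰⁰⁰`.
[cite: Zhang2022LandauSiegel, §16 (16.10)–(16.11) p.92] [cite: MontgomeryVaughan2007, §6.2] -/
theorem integral_u023_sub_residues_le (h21 : Step16_u021an c') (h22 : Step16_u022 c') :
    ∃ c C : ℝ, ForAllLarge fun D _ χ => AssumptionA D χ →
      ∀ d l : ℕ, 1 ≤ d → 1 ≤ l → ((d * l : ℕ) : ℝ) < Skeleton.P2 D ^ 2 →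
        ‖(1 / (2 * π) : ℂ) * (∫ t : ℝ, integrand16_u023 c' χ d l (1 + t * I)) -
            ∑ j ∈ ({1, 2} : Finset ℕ),
              calR2 c' χ j * (d : ℂ) ^ betaJ c' D j * calM2 c' χ d l (1 - betaJ c' D j)‖ ≤
          C * (∏ q ∈ (d * l).primeFactors, (1 + c / (q : ℝ) ^ (9 / 10 : ℝ))) * (ell D ^ 2000)⁻¹ := by
  -- the packages
  obtain ⟨c₂₂, C₂₂, D₂₂, h22'⟩ := h22
  obtain ⟨D₂₁, h21'⟩ := h21
  obtain ⟨cL, hcL, hcL4, CL, hCL, K₅, hK₅, DE, hE⟩ := Lemma84.exceptional_package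
  obtain ⟨cbar, hcbar, -, Cζ, hCζ, hζ⟩ := ZetaClassicalRegion.exists_zeroFreeRegion_bounds
  obtain ⟨rζ, hrζ, Kζ, -, hζ1⟩ := ResidueValues.zeta_near_one
  obtain ⟨CLβ, -, DLβ, hLβ⟩ := ResidueValues.L_one_sub_beta_bounds
  obtain ⟨Lb, -, hbudget⟩ := gauss_budget_le_one
  obtain ⟨Lg, -, hG⟩ := rpow_le_exp_mul_rpow (k := 2020) (κ := 9 * cL / 4) (ε := 1 / 10)
    (by norm_num) (by positivity) (by norm_num)
  have hκ₂0 : 0 < 8 * cbar / cL := by positivity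
  -- the threshold
  obtain ⟨L₀, hL₀64, hL₀b, hL₀g, hL₀κ, hL₀17, hL₀K1, hL₀K2, hL₀K3⟩ : ∃ L₀ : ℝ, 64 ≤ L₀ ∧ Lb ≤ L₀ ∧
      Lg ≤ L₀ ∧ max 4 ((41 / (8 * cbar / cL)) ^ 2) ≤ L₀ ∧ 1700 ≤ L₀ ∧ 16 * K₅ / cL + 1 ≤ L₀ ∧
      K₅ / rζ + 1 ≤ L₀ ∧ K₅ + 1 ≤ L₀ :=
    ⟨64 + |Lb| + |Lg| + max 4 ((41 / (8 * cbar / cL)) ^ 2) + 1700 + (16 * K₅ / cL + 1) +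
        (K₅ / rζ + 1) + (K₅ + 1), by
      have h1 : 0 ≤ max 4 ((41 / (8 * cbar / cL)) ^ 2) := le_trans (by norm_num) (le_max_left _ _)
      have h2 : 0 ≤ 16 * K₅ / cL + 1 := by positivity
      have h3 : 0 ≤ K₅ / rζ + 1 := by positivity
      have h4 : 0 ≤ K₅ + 1 := by positivity
      have h5 := le_abs_self Lb
      have h6 := le_abs_self Lg
      have h7 := abs_nonneg Lb
      have h8 := abs_nonneg Lg
      refine ⟨by linarith, by linarith, by linarith, by linarith, by linarith, by linarith,
        by linarith, by linarith⟩⟩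
  refine ⟨c₂₂, C₂₂ * (48 / π +
      1 / (2 * π) * ((8 / cL + Cζ) * Cζ * (2 * (CL + 1)) * (1 + 16 / cL) * (24 / cL) * 4) +
      36 * (1 + Cζ) * Cζ * (CL + 1) / π + 2 * (CL + 1) * (2 / π + Cζ) * (2 * K₅) * 3 * (3 / π)),
    max (max ⌈Real.exp 3⌉₊ ⌈Real.exp (14 * |c'| * π)⌉₊)
      (max (max D₂₁ D₂₂) (max (max DE DLβ) ⌈Real.exp L₀⌉₊)),
    fun D _ χ hD hq hp hA_ d l hd1 hl1 hdl => ?_⟩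
  -- unpack the threshold
  have hDth : max ⌈Real.exp 3⌉₊ ⌈Real.exp (14 * |c'| * π)⌉₊ ≤ D := le_trans (le_max_left _ _) hD
  have hD' : max (max D₂₁ D₂₂) (max (max DE DLβ) ⌈Real.exp L₀⌉₊) ≤ D := le_trans (le_max_right _ _) hD
  have hD₂₁ : D₂₁ ≤ D := le_trans (le_trans (le_max_left _ _) (le_max_left _ _)) hD'
  have hD₂₂ : D₂₂ ≤ D := le_trans (le_trans (le_max_right _ _) (le_max_left _ _)) hD'
  have hDE : DE ≤ D := le_trans (le_trans (le_trans (le_max_left _ _) (le_max_left _ _)) (le_max_right _ _)) hD'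
  have hDLβ : DLβ ≤ D :=
    le_trans (le_trans (le_trans (le_max_right _ _) (le_max_left _ _)) (le_max_right _ _)) hD'
  have hDL₀ : ⌈Real.exp L₀⌉₊ ≤ D := le_trans (le_trans (le_max_right _ _) (le_max_right _ _)) hD'
  obtain ⟨hL3, he⟩ := ResidueValues.thresholds c' hDth
  have hLL₀ : L₀ ≤ ell D := by
    have h : Real.exp L₀ ≤ D := le_trans (Nat.le_ceil _) (by exact_mod_cast hDL₀)
    exact (Real.le_log_iff_exp_le (lt_of_lt_of_le (Real.exp_pos _) h)).mpr h
  set L : ℝ := ell D with hLdef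
  clear_value L
  have hL3' : 3 ≤ ell D := by rw [← hLdef]; exact hL3
  have he' : |c' * alpha D * ell D| ≤ 1 / 14 := by rw [← hLdef]; exact he
  have hL64 : 64 ≤ L := le_trans hL₀64 hLL₀
  have hLb : Lb ≤ L := le_trans hL₀b hLL₀
  have hLg : Lg ≤ L := le_trans hL₀g hLL₀
  have hLκ₂ : max 4 ((41 / (8 * cbar / cL)) ^ 2) ≤ L := le_trans hL₀κ hLL₀
  have hL1700 : 1700 ≤ L := le_trans hL₀17 hLL₀
  have hLK1 : 16 * K₅ / cL + 1 ≤ L := le_trans hL₀K1 hLL₀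
  have hLK2 : K₅ / rζ + 1 ≤ L := le_trans hL₀K2 hLL₀
  have hLK3 : K₅ + 1 ≤ L := le_trans hL₀K3 hLL₀
  have hL1 : 1 ≤ L := by linarith only [hL64]
  have hL0 : 0 < L := by linarith only [hL64]
  -- the shifts and `P₄`
  obtain ⟨hb1l, hb1u, hb2l, hb2u, hb12, hb1', hb2', hβ1n, hα, hαeq⟩ := b_sizes c' hL3' he'
  rw [← hLdef] at hαeq
  obtain ⟨hP1, hP4le⟩ := P4_sizes hL3'
  rw [← hLdef] at hP4le
  have hb1 : 0 < b1 c' D := by linarith only [hb1l, hα]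
  have hb2 : 0 < b2 c' D := by linarith only [hb2l, hα]
  have hb1π : π / L ^ 9 / 2 ≤ b1 c' D := by rw [← hαeq]; exact hb1l
  have hb2π : π / L ^ 9 ≤ b2 c' D := by rw [← hαeq]; exact hb2l
  -- the character
  have hχ1 : χ ≠ 1 := by
    have hD1 : D ≠ 1 := by rintro rfl; rw [hLdef] at hL3; norm_num [ell] at hL3
    exact GammaFactor.ne_one_of_isPrimitive hp hD1
  have hd : d ≠ 0 := by omega
  -- the `ℳ₂` package
  have hM_diff : DifferentiableOn ℂ (calM2 c' χ d l) {s : ℂ | 9 / 10 < s.re} :=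
    h21' D χ hD₂₁ hq hp d l hd1 hl1
  obtain ⟨W, hW⟩ : ∃ W : ℝ, W = ∏ q ∈ (d * l).primeFactors, (1 + c₂₂ / (q : ℝ) ^ (9 / 10 : ℝ)) :=
    ⟨_, rfl⟩
  obtain ⟨KM, hKM⟩ : ∃ KM : ℝ, KM = C₂₂ * W := ⟨_, rfl⟩
  have hM_bd : ∀ w : ℂ, 9 / 10 < w.re → ‖calM2 c' χ d l w‖ ≤ KM := fun w hw => by
    rw [hKM, hW]; exact h22' D χ hD₂₂ hq hp d l hd1 hl1 w hw
  have hKM0 : 0 ≤ KM := le_trans (norm_nonneg _) (hM_bd 2 (by norm_num))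
  -- the parameters `H`, `ℒ₁`, `η`, `B_ζ`, `M_inv`
  obtain ⟨H, hH⟩ : ∃ H : ℝ, H = L ^ 20 := ⟨_, rfl⟩
  have hH2 : 2 ≤ H := by
    have : L ≤ L ^ 20 := le_self_pow₀ hL1 (by norm_num)
    rw [hH]; linarith only [this, hL64]
  have hH1 : 1 ≤ H := by linarith only [hH2]
  obtain ⟨ℒ₁, hℒ₁⟩ : ∃ ℒ₁ : ℝ, ℒ₁ = L + Real.log (H + 8) := ⟨_, rfl⟩
  have hlogH8 : 0 ≤ Real.log (H + 8) := Real.log_nonneg (by linarith only [hH1])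
  have hℒ₁L : L ≤ ℒ₁ := by rw [hℒ₁]; linarith only [hlogH8]
  have hlogH8L : Real.log (H + 8) ≤ L := by
    have h := log_pow_twenty_add_le (κ := 1) one_pos (L := L)
      (max_le (by linarith only [hL64]) (by norm_num; linarith only [hL1700]))
    rw [hH]; linarith only [h]
  have hℒ₁2L : ℒ₁ ≤ 2 * L := by rw [hℒ₁]; linarith only [hlogH8L]
  have hℒ₁0 : 0 < ℒ₁ := by linarith only [hℒ₁L, hL0]
  obtain ⟨η, hη⟩ : ∃ η : ℝ, η = cL / (4 * ℒ₁) := ⟨_, rfl⟩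
  have hη0 : 0 < η := by rw [hη]; positivity
  have hηup : η ≤ cL / (4 * L) := by
    rw [hη]; exact div_le_div_of_nonneg_left hcL.le (by positivity) (by linarith only [hℒ₁L])
  have hηlow : cL / (8 * L) ≤ η := by
    rw [hη]; exact div_le_div_of_nonneg_left hcL.le (by positivity) (by linarith only [hℒ₁2L])
  have hη20 : η ≤ 1 / 20 := by
    refine hηup.trans ?_
    rw [div_le_iff₀ (by positivity)]; linarith only [hcL4, hL64]
  have hη1 : η ≤ 1 := by linarith only [hη20]
  obtain ⟨Bζ, hBζ⟩ : ∃ Bζ : ℝ, Bζ = Cζ * Real.log (H + 5) := ⟨_, rfl⟩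
  have hlogH5 : 0 ≤ Real.log (H + 5) := Real.log_nonneg (by linarith only [hH1])
  have hBζ0 : 0 ≤ Bζ := by rw [hBζ]; positivity
  have hlogH5L : Real.log (H + 5) ≤ L := by
    have : Real.log (H + 5) ≤ Real.log (H + 8) :=
      Real.log_le_log (by linarith only [hH1]) (by linarith only [hH1])
    linarith only [this, hlogH8L]
  have hBζL : Bζ ≤ Cζ * L := by rw [hBζ]; exact mul_le_mul_of_nonneg_left hlogH5L hCζ.le
  obtain ⟨Minv, hMinv⟩ : ∃ Minv : ℝ, Minv = (CL + 1) * ℒ₁ := ⟨_, rfl⟩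
  have hMinv0 : 0 < Minv := by rw [hMinv]; positivity
  have hMinvL : Minv ≤ 2 * (CL + 1) * L := by
    rw [hMinv]
    have := mul_le_mul_of_nonneg_left hℒ₁2L (by positivity : (0 : ℝ) ≤ CL + 1)
    linarith only [this]
  -- the `ζ` package in the region `Re w ≥ 1 − 2η`, `|Im w| ≤ H + 2`
  have h2η : 2 * η ≤ 4 * cbar / Real.log (H + 5) := by
    have hlog8 : Real.log (L ^ 20 + 8) ≤ 8 * cbar / cL * L := log_pow_twenty_add_le hκ₂0 hLκ₂
    have hlog5 : Real.log (H + 5) ≤ 8 * cbar / cL * L := by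
      have : Real.log (H + 5) ≤ Real.log (L ^ 20 + 8) :=
        Real.log_le_log (by linarith only [hH1]) (by rw [hH]; linarith only [hH1])
      linarith only [this, hlog8]
    have hlog5pos : 0 < Real.log (H + 5) := Real.log_pos (by linarith only [hH1])
    calc 2 * η ≤ 2 * (cL / (4 * L)) := by linarith only [hηup]
      _ = 4 * cbar / (8 * cbar / cL * L) := by field_simp; ring
      _ ≤ 4 * cbar / Real.log (H + 5) :=
          div_le_div_of_nonneg_left (by positivity) hlog5pos hlog5
  have hζpk := zeta_package_of hcbar hCζ hζ hBζ h2η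
  -- the exceptional zero and the `L` package
  have hA' : ‖χ.LFunction 1‖ < (Real.log D ^ 2022)⁻¹ := by rw [← one_div]; exact hA_
  obtain ⟨ρt, hρ1, hρK, hLρ, hL'ρ, hLreg⟩ := hE D χ hDE hχ1 hA'
  have hLD : Real.log D = L := by rw [hLdef]; rfl
  have hρK' : 1 - ρt ≤ K₅ * (L ^ 2022)⁻¹ := by rw [← hLD]; exact hρK
  have hL2022 : L ≤ L ^ 2022 := le_self_pow₀ hL1 (by norm_num)
  have hKL : K₅ * (L ^ 2022)⁻¹ ≤ K₅ / L := by
    rw [div_eq_mul_inv]; exact mul_le_mul_of_nonneg_left (inv_anti₀ hL0 hL2022) hK₅.le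
  have hKL1 : K₅ / L ≤ 1 := by rw [div_le_one hL0]; linarith only [hLK3]
  have hρ0 : 0 ≤ ρt := by linarith only [hρK', hKL, hKL1]
  have hρη : 1 - η / 2 ≤ ρt := by
    have h1 : K₅ * (L ^ 2022)⁻¹ ≤ cL / (16 * L) := by
      have hL2021 : 16 * K₅ / cL ≤ L ^ 2021 := by
        have : L ≤ L ^ 2021 := le_self_pow₀ hL1 (by norm_num)
        linarith only [this, hLK1]
      rw [div_le_iff₀ hcL] at hL2021
      have hpow : L ^ 2022 = L * L ^ 2021 := by ring
      rw [← div_eq_mul_inv, div_le_div_iff₀ (by positivity) (by positivity), hpow]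
      have h16 : K₅ * (16 * L) = (16 * K₅) * L := by ring
      have hcc : cL * (L * L ^ 2021) = (L ^ 2021 * cL) * L := by ring
      rw [h16, hcc]
      exact mul_le_mul_of_nonneg_right hL2021 hL0.le
    have h2 : cL / (16 * L) ≤ η / 2 := by
      have : cL / (16 * L) = cL / (8 * L) / 2 := by ring
      rw [this]; linarith only [hηlow]
    linarith only [hρK', h1, h2]
  have hLpk := L_package_of hcL hCL hLreg hLD hL0 hH1 hℒ₁ hη hMinv
  -- `ζ` next to `1` at `ρ̃`
  have hζρ : ‖((ρt : ℂ) - 1) * riemannZeta ρt - 1‖ ≤ 1 / 2 := by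
    have hρne : (ρt : ℂ) ≠ 1 := by
      intro h
      have := congrArg Complex.re h
      simp only [Complex.ofReal_re, Complex.one_re] at this
      linarith only [this, hρ1]
    have hdist : ‖(ρt : ℂ) - 1‖ < rζ := by
      rw [← Complex.ofReal_one, ← Complex.ofReal_sub, Complex.norm_real, Real.norm_eq_abs,
        abs_of_nonpos (by linarith only [hρ1])]
      have hLr : K₅ / rζ < L := by linarith only [hLK2]
      rw [div_lt_iff₀ hrζ] at hLr
      have : K₅ / L < rζ := by rw [div_lt_iff₀ hL0]; linarith only [hLr]
      linarith only [this, hρK', hKL]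
    exact (hζ1 (ρt : ℂ) hρne hdist).2.2
  -- `L(1 − βⱼ, χ) ≠ 0`
  have hLβ' := hLβ D χ hDLβ hq hp hA_
  have hL1ne : χ.LFunction (1 - beta1 c' D) ≠ 0 :=
    (hLβ' (beta1 c' D) (ResidueValues.norm_beta_ge c' hL3' he').1
      ((ResidueValues.norm_beta1_le c' hL3' he').trans (by linarith only [hα]))).1
  have hL2ne : χ.LFunction (1 - beta2 c' D) ≠ 0 :=
    (hLβ' (beta2 c' D) (ResidueValues.norm_beta_ge c' hL3' he').2.1
      (ResidueValues.norm_beta2_le c' hL3' he')).1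
  -- `d ≤ P`, `d^{1−ρ̃} ≤ e`, `(d/P₄)^η ≤ e^{−18η𝓛^{1.1}}`
  have hdreal : (d : ℝ) ≤ ((d * l : ℕ) : ℝ) := by
    have : d ≤ d * l := Nat.le_mul_of_pos_right d (by omega)
    exact_mod_cast this
  have hdP : (d : ℝ) ≤ Real.exp (L ^ 9) := by
    have h1 := Typed.AppendixA1.P2_sq_le_bigP D
    have h2 : bigP D = Real.exp (L ^ 9) := by rw [bigP, hLdef]
    linarith only [hdreal, hdl, h1, h2.le]
  have hd1r : (1 : ℝ) ≤ d := by exact_mod_cast hd1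
  have hE5 : (d : ℝ) ^ (1 - ρt) ≤ Real.exp 1 := by
    rw [Real.rpow_def_of_pos (by positivity)]
    refine Real.exp_le_exp.mpr ?_
    have hlogd : Real.log d ≤ L ^ 9 := by
      have h := Real.log_le_log (by positivity) hdP
      rwa [Real.log_exp] at h
    have hlogd0 : 0 ≤ Real.log d := Real.log_nonneg hd1r
    have h9 : K₅ * (L ^ 2022)⁻¹ * L ^ 9 ≤ 1 := by
      have hL2013 : K₅ ≤ L ^ 2013 := by
        have : L ≤ L ^ 2013 := le_self_pow₀ hL1 (by norm_num)
        linarith only [this, hLK3]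
      have hpow : L ^ 2022 = L ^ 2013 * L ^ 9 := by ring
      rw [hpow, mul_inv, mul_assoc, inv_mul_cancel_right₀ (pow_ne_zero 9 hL0.ne')]
      rw [← div_eq_mul_inv, div_le_one (by positivity)]
      exact hL2013
    calc Real.log d * (1 - ρt) ≤ L ^ 9 * (K₅ * (L ^ 2022)⁻¹) :=
          mul_le_mul hlogd hρK' (by linarith only [hρ1]) (by positivity)
      _ ≤ 1 := by linarith only [h9]
  have hdPη : ((d : ℝ) / P4 D) ^ η ≤ Real.exp (-(18 * η * L ^ (1.1 : ℝ))) := by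
    have h := div_P4_rpow_le hL3' hdreal hdl hη0.le
    rwa [← hLdef] at h
  -- the Gaussian budget and the stretched exponential
  have hg0 : 0 ≤ GaussWeight.gauss (4 * L ^ 30)⁻¹ (H - |b2 c' D|) := (GaussWeight.gauss_pos _ _).le
  have hgb : L ^ 2600 * Real.exp (2 * L ^ 9 + 2) * GaussWeight.gauss (4 * L ^ 30)⁻¹ (H - |b2 c' D|) ≤
      1 := by
    have hgle : GaussWeight.gauss (4 * L ^ 30)⁻¹ (H - |b2 c' D|) ≤
        Real.exp (-(L ^ 20 - 1) ^ 2 / (4 * L ^ 30)) := by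
      rw [GaussWeight.gauss, abs_of_pos hb2]
      refine Real.exp_le_exp.mpr ?_
      have h20 : 1 ≤ L ^ 20 := one_le_pow₀ hL1
      have h1 : (L ^ 20 - 1) ^ 2 ≤ (H - b2 c' D) ^ 2 := by
        rw [hH]
        exact pow_le_pow_left₀ (by linarith only [h20]) (by linarith only [hb2']) 2
      rw [neg_div, neg_mul, neg_le_neg_iff, div_eq_inv_mul]
      exact mul_le_mul_of_nonneg_left h1 (by positivity)
    have hb := hbudget L hLb
    have hL2600 : L ^ (2600 : ℝ) = L ^ 2600 := by norm_cast
    rw [hL2600] at hb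
    exact le_trans (mul_le_mul_of_nonneg_left hgle (by positivity)) hb
  have hG' : L ^ (2020 : ℝ) ≤ Real.exp (9 * cL / 4 * L ^ (1 / 10 : ℝ)) := hG L hLg
  -- the local theorem and the numerics
  have hell1 : 1 ≤ ell D := by rw [← hLdef]; exact hL1
  have hloc := integral_u023_sub_residues_le_local c' χ d l hχ1 hd (E := Real.exp 1) hη0 hη20 hH2
    hell1 hP1 hb1 hb1' hb2 hb2' hb12 hβ1n hM_diff hKM0 hM_bd hBζ0 hζpk hMinv0 hρ0 hρ1 hρη hLρ hL'ρ
    hLpk hζρ hL1ne hL2ne hE5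
  rw [← hLdef] at hloc
  refine hloc.trans ?_
  have hWrw : C₂₂ * (48 / π +
      1 / (2 * π) * ((8 / cL + Cζ) * Cζ * (2 * (CL + 1)) * (1 + 16 / cL) * (24 / cL) * 4) +
      36 * (1 + Cζ) * Cζ * (CL + 1) / π + 2 * (CL + 1) * (2 / π + Cζ) * (2 * K₅) * 3 * (3 / π)) *
      (∏ q ∈ (d * l).primeFactors, (1 + c₂₂ / (q : ℝ) ^ (9 / 10 : ℝ))) * (L ^ 2000)⁻¹ =
      KM * (48 / π +
      1 / (2 * π) * ((8 / cL + Cζ) * Cζ * (2 * (CL + 1)) * (1 + 16 / cL) * (24 / cL) * 4) +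
      36 * (1 + Cζ) * Cζ * (CL + 1) / π + 2 * (CL + 1) * (2 / π + Cζ) * (2 * K₅) * 3 * (3 / π)) *
      (L ^ 2000)⁻¹ := by rw [hKM, hW]; ring
  rw [hWrw]
  exact numeric_bound hL64 hη0 hη1 hηlow hcL hH hBζ0 hBζL hCζ hMinv0 hMinvL hCL hKM0 hρ1 hρK' hK₅
    hb1π hb2π hb2' hP1 hP4le hd1r hdP hdPη hg0 hgb hG'

/-- **(16.10) with the derivable error term.** From the displays §16.u023, §16.u021an, §16.u022
(all hypotheses BY NAME): there are `c₁, C₁, c, C` such that for all large `D`, every real primitive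
`χ (mod D)` with (A), and all `d, l ≥ 1` with `dl < P₂²`,
`‖𝒟₂(d,l) − λ₂(d)·Σ_{j=1,2} ℛ₂ⱼ d^{βⱼ} ℳ₂(d,l;1−βⱼ)‖ ≤ C₁e^{−c₁𝓛¹⁰} + C‖λ₂(d)‖∏_{q∣dl}(1 + c/q^{9/10})𝓛⁻²⁰⁰⁰`.
(The manuscript's `O(ε₁)`, `ε₁ = exp{−c𝓛^{1/10}}` as typed in `Eq16_10`, is not derivable: the residue
at the exceptional-zero pole `ρ̃ − 1` is only `O(𝓛⁻²⁰⁰³‖ℳ₂‖)` under (A); see the module docstring. The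
hypothesis `(dl, D) = 1` of (16.10) is not needed for this estimate.)
[cite: Zhang2022LandauSiegel, §16 (16.10) p.92] -/
theorem eq16_10P_of (h23 : Step16_u023 c') (h21 : Step16_u021an c') (h22 : Step16_u022 c') :
    ∃ c₁ C₁ c C : ℝ, ForAllLarge fun D _ χ => AssumptionA D χ →
      ∀ d l : ℕ, 1 ≤ d → 1 ≤ l → ((d * l : ℕ) : ℝ) < Skeleton.P2 D ^ 2 →
        ‖calD2 c' χ d l - lam2 c' χ d 1 * ∑ j ∈ ({1, 2} : Finset ℕ),
            calR2 c' χ j * (d : ℂ) ^ betaJ c' D j * calM2 c' χ d l (1 - betaJ c' D j)‖ ≤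
          C₁ * Real.exp (-c₁ * ell D ^ 10) +
            C * ‖lam2 c' χ d 1‖ * (∏ q ∈ (d * l).primeFactors, (1 + c / (q : ℝ) ^ (9 / 10 : ℝ))) *
              (ell D ^ 2000)⁻¹ := by
  obtain ⟨c₁, -, C₁, D₁, h23'⟩ := h23
  obtain ⟨c, C, D₂, hA⟩ := integral_u023_sub_residues_le c' h21 h22
  refine ⟨c₁, C₁, c, C, max D₁ D₂, fun D _ χ hD hq hp hA_ d l hd1 hl1 hdl => ?_⟩
  have hD₁ : D₁ ≤ D := le_trans (le_max_left _ _) hD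
  have hD₂ : D₂ ≤ D := le_trans (le_max_right _ _) hD
  have hdlP : ((d * l : ℕ) : ℝ) < bigP D := lt_of_lt_of_le hdl (Typed.AppendixA1.P2_sq_le_bigP D)
  have h1 := h23' D χ hD₁ hq hp hA_ d l hd1 hl1 hdlP
  have h2 := hA D χ hD₂ hq hp hA_ d l hd1 hl1 hdl
  set I0 : ℂ := (1 / (2 * π) : ℂ) * ∫ t : ℝ, integrand16_u023 c' χ d l (1 + t * I) with hI0
  set V : ℂ := ∑ j ∈ ({1, 2} : Finset ℕ),
    calR2 c' χ j * (d : ℂ) ^ betaJ c' D j * calM2 c' χ d l (1 - betaJ c' D j) with hV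
  have hsplit : calD2 c' χ d l - lam2 c' χ d 1 * V =
      (calD2 c' χ d l - lam2 c' χ d 1 * I0) + lam2 c' χ d 1 * (I0 - V) := by ring
  calc ‖calD2 c' χ d l - lam2 c' χ d 1 * V‖
      ≤ ‖calD2 c' χ d l - lam2 c' χ d 1 * I0‖ + ‖lam2 c' χ d 1 * (I0 - V)‖ := by
        rw [hsplit]; exact norm_add_le _ _
    _ ≤ C₁ * Real.exp (-c₁ * ell D ^ 10) +
        ‖lam2 c' χ d 1‖ * (C * (∏ q ∈ (d * l).primeFactors, (1 + c / (q : ℝ) ^ (9 / 10 : ℝ))) *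
          (ell D ^ 2000)⁻¹) := by
        rw [norm_mul]
        exact add_le_add h1 (mul_le_mul_of_nonneg_left h2 (norm_nonneg _))
    _ = C₁ * Real.exp (-c₁ * ell D ^ 10) +
        C * ‖lam2 c' χ d 1‖ * (∏ q ∈ (d * l).primeFactors, (1 + c / (q : ℝ) ^ (9 / 10 : ℝ))) *
          (ell D ^ 2000)⁻¹ := by ring

end Main

end Literature.NumberTheory.LFunctions.Zhang2022.Eq1610
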